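import Mathlib.NumberTheory.NumberField.CMField
import Mathlib.NumberTheory.NumberField.Completion.Ramification

/-!
# Tier-5 support (seat p3, cell pub-hodge-repro2) — the infinite places of a CM field:
exactly one place of `K` above each (real) place of `K⁺`, ramified, of local degree `2`

Behind route/T4-B1-p3.md v7 (sub-claim B1, FINAL) l. 22 «for a place v of F⁺ write n_v ∈ {1, 2}
for the local degree of F/F⁺ at v (…; n_v = 2 ⟺ exactly one place of F above v); the three real
places have n_v = 2» and l. 33 «at a real place τ of F⁺, F ⊗_{F⁺,τ} ℝ ≅ ℂ (n_τ = 2)», in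
Mathlib's own vocabulary for `NumberField.IsCMField K`, `K⁺ = maximalRealSubfield K`:

* every infinite place `v` of `K⁺` is real and every infinite place `w` of `K` is complex
  (`isReal`, `isComplex`; `IsTotallyReal` / `IsTotallyComplex`);
* `w` lies over `v` (`w.1.LiesOver v.1`, Mathlib's `AbsoluteValue.LiesOver`) iff
  `w.comap (algebraMap K⁺ K) = v` (`liesOver_iff_comap_eq`), and for every `v` there is EXACTLY
  ONE such `w` (`existsUnique_comap_eq`, from Mathlib's `IsCMField.equivInfinitePlace`;
  `placesOver_eq_singleton`: `v.placesOver K = {placeOver K v}`);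
* that `w` is ramified over `v` (`isRamified`: `w` complex over `v` real), so
  `unramifiedPlacesOver K v = ∅`, `ramifiedPlacesOver K v = v.placesOver K`, the local degree is
  `[w.Completion : v.Completion] = 2` (`finrank_completion_eq_two`, Mathlib's
  `finrank_eq_two_of_isRamified`), the inertia degree is `2` (`inertiaDeg_eq_two`) and
  `∑_{w ∣ v} f(w ∣ v) = 2 = [K : K⁺]` (`sum_inertiaDeg_eq_two`, Mathlib's
  `sum_inertiaDeg_eq_finrank`) — B1's «n_v = 2 at the real places»;
* the completions: `v.Completion ≃+* ℝ` and `w.Completion ≃+* ℂ` (`realCompletionEquiv`,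
  `complexCompletionEquiv`; Mathlib's `ringEquivRealOfIsReal` / `ringEquivComplexOfIsComplex`) —
  B1's `F⁺_τ = ℝ`, `F_τ = ℂ`.

The algebraic identification `ℝ ⊗[K⁺] K ≅ ℂ` itself is file 102 (`T5CMRealBaseChange`).
Nothing here is a display; Mathlib only, no cell import. Header declaration (README §8(d)):
uses an L-value-free non-vanishing device: NO.
-/

open NumberField NumberField.InfinitePlace
open scoped NumberField.LiesOver

namespace Summit.Ventures.HodgeRepro2.T5CMInfinitePlaces

variable (K : Type*) [Field K] [NumberField K] [IsCMField K]

/-! ## 1. Real below, complex above -/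

omit [IsCMField K] in
/-- Every infinite place of `K⁺` is real (`K⁺` is totally real). -/
theorem isReal (v : InfinitePlace (maximalRealSubfield K)) : v.IsReal :=
  IsTotallyReal.isReal v

/-- Every infinite place of `K` is complex (`K` is totally complex). -/
theorem isComplex (w : InfinitePlace K) : w.IsComplex :=
  IsTotallyComplex.isComplex w

/-! ## 2. Lying over = restriction, and exactly one place above each place of `K⁺` -/

omit [NumberField K] [IsCMField K] in
/-- `w` lies over `v` iff `w` restricts to `v` along `K⁺ ⊆ K`. -/
theorem liesOver_iff_comap_eq (v : InfinitePlace (maximalRealSubfield K)) (w : InfinitePlace K) :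
    w.1.LiesOver v.1 ↔ w.comap (algebraMap (maximalRealSubfield K) K) = v :=
  ⟨fun _ => LiesOver.comap_eq w v, fun h => ⟨congrArg Subtype.val h⟩⟩

/-- THE place of `K` above `v` (Mathlib's `IsCMField.equivInfinitePlace`, inverted). -/
noncomputable def placeOver (v : InfinitePlace (maximalRealSubfield K)) : InfinitePlace K :=
  (IsCMField.equivInfinitePlace K).symm v

/-- `placeOver K v` restricts to `v`. -/
theorem comap_placeOver (v : InfinitePlace (maximalRealSubfield K)) :
    (placeOver K v).comap (algebraMap (maximalRealSubfield K) K) = v :=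
  (IsCMField.equivInfinitePlace K).apply_symm_apply v

/-- `placeOver K v` lies over `v`. -/
instance liesOver_placeOver (v : InfinitePlace (maximalRealSubfield K)) :
    (placeOver K v).1.LiesOver v.1 :=
  (liesOver_iff_comap_eq K v _).mpr (comap_placeOver K v)

/-- A place of `K` restricting to `v` is `placeOver K v`. -/
theorem eq_placeOver_of_comap_eq {v : InfinitePlace (maximalRealSubfield K)} {w : InfinitePlace K}
    (h : w.comap (algebraMap (maximalRealSubfield K) K) = v) : w = placeOver K v :=
  (IsCMField.equivInfinitePlace K).injective (h.trans (comap_placeOver K v).symm)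

/-- B1 l. 22, «exactly one place of F above v» for the real places: for every infinite place `v`
of `K⁺` there is exactly one infinite place of `K` restricting to `v`. -/
theorem existsUnique_comap_eq (v : InfinitePlace (maximalRealSubfield K)) :
    ∃! w : InfinitePlace K, w.comap (algebraMap (maximalRealSubfield K) K) = v :=
  ⟨placeOver K v, comap_placeOver K v, fun _ h => eq_placeOver_of_comap_eq K h⟩

/-- The places of `K` over `v` form the singleton `{placeOver K v}`. -/
theorem placesOver_eq_singleton (v : InfinitePlace (maximalRealSubfield K)) :
    v.placesOver K = {placeOver K v} := by
  ext w
  simp only [placesOver, Set.mem_setOf_eq, Set.mem_singleton_iff, liesOver_iff_comap_eq]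
  exact ⟨fun h => eq_placeOver_of_comap_eq K h, fun h => h ▸ comap_placeOver K v⟩

/-! ## 3. Ramified, local degree `2`, inertia degree `2` -/

/-- Every place of `K` over a place of `K⁺` is ramified (complex over real). -/
theorem isRamified (v : InfinitePlace (maximalRealSubfield K)) (w : InfinitePlace K)
    [w.1.LiesOver v.1] : w.IsRamified (maximalRealSubfield K) :=
  isRamified_iff.mpr ⟨isComplex K w, by rw [LiesOver.comap_eq w v]; exact isReal K v⟩

/-- `ramifiedPlacesOver K v = v.placesOver K`. -/
theorem ramifiedPlacesOver_eq (v : InfinitePlace (maximalRealSubfield K)) :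
    ramifiedPlacesOver K v = v.placesOver K := by
  ext w
  exact ⟨fun h => h.1, fun h => ⟨h, by haveI : w.1.LiesOver v.1 := h; exact isRamified K v w⟩⟩

/-- `unramifiedPlacesOver K v = ∅`. -/
theorem unramifiedPlacesOver_eq_empty (v : InfinitePlace (maximalRealSubfield K)) :
    unramifiedPlacesOver K v = ∅ := by
  ext w
  simp only [Set.mem_empty_iff_false, iff_false]
  intro h
  haveI : w.1.LiesOver v.1 := h.1
  exact isRamified K v w h.2

/-- B1 l. 22 / l. 33, «n_τ = 2»: the local degree `[K_w : K⁺_v]` is `2` (Mathlib's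
`finrank_eq_two_of_isRamified`). -/
theorem finrank_completion_eq_two (v : InfinitePlace (maximalRealSubfield K)) (w : InfinitePlace K)
    [w.1.LiesOver v.1] : Module.finrank v.Completion w.Completion = 2 :=
  Completion.finrank_eq_two_of_isRamified v (isRamified K v w)

/-- The inertia degree of `w` over `v` is `2`. -/
theorem inertiaDeg_eq_two (v : InfinitePlace (maximalRealSubfield K)) (w : InfinitePlace K)
    [w.1.LiesOver v.1] : v.inertiaDeg w = 2 :=
  InfinitePlace.inertiaDeg_eq_two ⟨inferInstance, isRamified K v w⟩

open scoped Classical in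
/-- Consistency with Mathlib's `sum_inertiaDeg_eq_finrank`: `∑_{w ∣ v} f(w ∣ v) = [K : K⁺] = 2`. -/
theorem sum_inertiaDeg_eq_two (v : InfinitePlace (maximalRealSubfield K)) :
    ∑ w ∈ v.placesOver K, v.inertiaDeg w = 2 := by
  rw [sum_inertiaDeg_eq_finrank (maximalRealSubfield K) K v,
    Algebra.IsQuadraticExtension.finrank_eq_two (maximalRealSubfield K) K]

/-! ## 4. The completions: `K⁺_v ≅ ℝ`, `K_w ≅ ℂ` -/

/-- `v.Completion ≃+* ℝ` for every infinite place `v` of `K⁺` (Mathlib's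
`ringEquivRealOfIsReal`). -/
noncomputable def realCompletionEquiv (v : InfinitePlace (maximalRealSubfield K)) :
    v.Completion ≃+* ℝ :=
  Completion.ringEquivRealOfIsReal (isReal K v)

/-- `w.Completion ≃+* ℂ` for every infinite place `w` of `K` (Mathlib's
`ringEquivComplexOfIsComplex`). -/
noncomputable def complexCompletionEquiv (w : InfinitePlace K) : w.Completion ≃+* ℂ :=
  Completion.ringEquivComplexOfIsComplex (isComplex K w)

end Summit.Ventures.HodgeRepro2.T5CMInfinitePlaces
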